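import Literature.Probability.Percolation.HierarchicalMaxRenormalisation
import Mathlib.Analysis.Complex.ExponentialBounds
import HarnessLib

/-!
# Hierarchical long-range percolation: renormalisation of `M_B` (Hutchcroft 2022, Lemma 2.6)

Topic `Literature/Probability/Percolation`. Theorem-only sequel of
`HierarchicalMaxRenormalisation.lean` proving Hutchcroft 2022, Lemma 2.6 ("Renormalization of the
maximum cluster size") for the labelled hierarchical model `hierLaw` (toward the named fact
`Hutchcroft2022_twoPoint_volumeTail`): there is `L₀ = L₀(d,α)` and, for `L ≥ L₀`, a constant
`A = A(d,α,L)` such that for every good `n`-block `B` (child of `σ(B) = B_{n+1}(x)`)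

  `M_B² ≥ (A/(cβ)) L^{(d+α)n}  ⟹  M_{σ(B)}² ≥ (A/(cβ)) L^{(d+α)(n+1)}`

(`Mblock_sq_renormalisation`; the paper normalises `c = 1`). The proof is the printed one: among
the `≥ L^d/2` siblings `B'` with `E|K^max_{B'}| ≥ E|K^max_B|` (so `M_{B'} ≥ M_B/24` by (2.7)), by the
lower tail (2.5) and Markov's inequality at least half have `|K^max_{B'}(η_B)| ≥ M_B/1536` with
probability `≥ 3/4`; conditionally on `η_B` the maximal traces `D_i` of two such siblings fail to be
joined by an edge of `ω_{σ(B)}` with probability `exp(-cβL^{-(d+α)(n+1)}|D_i||D_j|)`, and a union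
bound over the `≤ L^{2d}` pairs plus (2.4) `η_{σ(B)} = η_B ∪ ω_{σ(B)}` give
`P(|K^max_{σ(B)}| ≥ L^{(d+α)/2} M_B) ≥ 1/2 > 1/e`, whence `M_{σ(B)} > L^{(d+α)/2} M_B` once
`L^{(d-α)/2} ≥ 12288`. Constants differ from the printed ones (our (2.5)–(2.7) carry the constants of
`UniversalTightness.lean`); only their universality matters.

Also: the connectivity pattern on a finite set determines `|K_max|`, `maxTrace` (measurability of
their fibres, `measurableSet_maxTrace_eq`).

## References

* [Hutchcroft2022] T. Hutchcroft, J. Math. Phys. 63 (2022), arXiv:2202.07634, Lemma 2.6 and its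
  proof (pp. 9–10), (2.4), (2.5), (2.7), (2.10).
-/

noncomputable section

namespace Literature.Probability.Percolation

open Finset Literature.Probability.LatticeModels

variable {d : ℕ}

/-! ### Functions of the connectivity pattern -/

section ReachCongr

variable {V : Type*}

/-- **`|K_v ∩ Λ|` (for `v ∈ Λ`) only depends on the connectivity pattern on `Λ`.** [folklore] -/
theorem clusterCapIn_congr_of_reachable (Λ : Finset V) {ω ω' : BondConfig V}
    (h : ∀ a ∈ Λ, ∀ b ∈ Λ, ((openGraph ω).Reachable a b ↔ (openGraph ω').Reachable a b)) {v : V}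
    (hv : v ∈ Λ) : clusterCapIn Λ ω v = clusterCapIn Λ ω' v := by
  classical
  rw [clusterCapIn_eq, clusterCapIn_eq, Finset.filter_congr fun z hz => h v hv z hz]

/-- **`|K_max(Λ)|` only depends on the connectivity pattern on `Λ`.** [folklore] -/
theorem clusterMaxIn_congr_of_reachable (Λ : Finset V) {ω ω' : BondConfig V}
    (h : ∀ a ∈ Λ, ∀ b ∈ Λ, ((openGraph ω).Reachable a b ↔ (openGraph ω').Reachable a b)) :
    clusterMaxIn Λ ω = clusterMaxIn Λ ω' :=
  Finset.sup_congr rfl fun _ hv => clusterCapIn_congr_of_reachable Λ h hv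

/-- `maxVertex` only depends on the connectivity pattern on `Λ`. [folklore] -/
theorem maxVertex_congr_of_reachable (Λ : Finset V) {ω ω' : BondConfig V}
    (h : ∀ a ∈ Λ, ∀ b ∈ Λ, ((openGraph ω).Reachable a b ↔ (openGraph ω').Reachable a b)) :
    maxVertex Λ ω = maxVertex Λ ω' := by
  classical
  unfold maxVertex
  refine List.find?_congr fun v hv => ?_
  rw [clusterCapIn_congr_of_reachable Λ h (Finset.mem_toList.1 hv), clusterMaxIn_congr_of_reachable Λ h]

/-- **The maximal trace only depends on the connectivity pattern on `Λ`.** [folklore] -/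
theorem maxTrace_congr_of_reachable (Λ : Finset V) {ω ω' : BondConfig V}
    (h : ∀ a ∈ Λ, ∀ b ∈ Λ, ((openGraph ω).Reachable a b ↔ (openGraph ω').Reachable a b)) :
    maxTrace Λ ω = maxTrace Λ ω' := by
  classical
  have hmv := maxVertex_congr_of_reachable Λ h
  unfold maxTrace
  rw [hmv]
  cases hv : maxVertex Λ ω' with
  | none => rfl
  | some v =>
    have hvΛ : v ∈ Λ := by
      unfold maxVertex at hv
      exact Finset.mem_toList.1 (List.mem_of_find?_eq_some hv)
    simp only
    exact Finset.filter_congr fun z hz => h v hvΛ z hz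

/-- **Fibres of a function of the connectivity pattern on a finite set are measurable** (`V`
countable): the pattern `{(a,b) ∈ Λ² : a ↔ b}` takes finitely many values, each on a measurable set.
[folklore] -/
theorem measurableSet_fiber_of_reach_congr [Countable V] (Λ : Finset V) {γ : Type*}
    (f : BondConfig V → γ)
    (hf : ∀ ω ω' : BondConfig V, (∀ a ∈ Λ, ∀ b ∈ Λ,
      ((openGraph ω).Reachable a b ↔ (openGraph ω').Reachable a b)) → f ω = f ω') (y : γ) :
    MeasurableSet {ω | f ω = y} := by
  classical
  -- the connectivity pattern on `Λ`
  set R : BondConfig V → Finset (V × V) := fun ω =>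
    (Λ ×ˢ Λ).filter fun p => (openGraph ω).Reachable p.1 p.2 with hR
  have hfib : ∀ P : Finset (V × V), MeasurableSet {ω | R ω = P} := by
    intro P
    by_cases hP : P ⊆ Λ ×ˢ Λ
    · have hset : {ω | R ω = P} = ⋂ p ∈ Λ ×ˢ Λ, {ω | (openGraph ω).Reachable p.1 p.2 ↔ p ∈ P} := by
        ext ω
        simp only [Set.mem_setOf_eq, Set.mem_iInter, hR]
        constructor
        · intro hω p hp
          rw [← hω, Finset.mem_filter]
          exact ⟨fun h => ⟨hp, h⟩, fun h => h.2⟩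
        · intro hω
          ext p
          rw [Finset.mem_filter]
          constructor
          · rintro ⟨hp, hr⟩; exact (hω p hp).1 hr
          · intro hpP; exact ⟨hP hpP, (hω p (hP hpP)).2 hpP⟩
      rw [hset]
      refine Finset.measurableSet_biInter _ fun p hp => ?_
      by_cases hpP : p ∈ P
      · simp only [hpP, iff_true]; exact measurableSet_openConn_holds p.1 p.2
      · simp only [hpP, iff_false]; exact (measurableSet_openConn_holds p.1 p.2).compl
    · have hset : {ω | R ω = P} = ∅ :=
        Set.eq_empty_of_forall_notMem fun ω hω => hP (hω ▸ Finset.filter_subset _ _)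
      rw [hset]; exact MeasurableSet.empty
  -- `f` factors through `R`
  have hfac : ∀ ω ω', R ω = R ω' → f ω = f ω' := by
    intro ω ω' hRR
    refine hf ω ω' fun a ha b hb => ?_
    have := Finset.ext_iff.1 hRR (a, b)
    simp only [hR, Finset.mem_filter, Finset.mem_product] at this
    tauto
  have hset : {ω | f ω = y} =
      ⋃ P ∈ (Λ ×ˢ Λ).powerset.filter (fun P => ∃ ω₀, R ω₀ = P ∧ f ω₀ = y), {ω | R ω = P} := by
    ext ω
    simp only [Set.mem_setOf_eq, Set.mem_iUnion, Finset.mem_filter, Finset.mem_powerset,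
      exists_prop]
    constructor
    · intro hω; exact ⟨R ω, ⟨Finset.filter_subset _ _, ω, rfl, hω⟩, rfl⟩
    · rintro ⟨P, ⟨-, ω₀, hω₀, hy⟩, hωP⟩
      rw [hfac ω ω₀ (hωP.trans hω₀.symm)]; exact hy
  rw [hset]
  exact Finset.measurableSet_biUnion _ fun P _ => hfib P

/-- `{maxTrace Λ = D}` is measurable. [folklore] -/
theorem measurableSet_maxTrace_eq [Countable V] (Λ D : Finset V) :
    MeasurableSet {ω : BondConfig V | maxTrace Λ ω = D} :=
  measurableSet_fiber_of_reach_congr Λ (maxTrace Λ) (fun _ _ h => maxTrace_congr_of_reachable Λ h) D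

/-- `{r ≤ |K_max(Λ)|}` (real threshold) is measurable. [folklore] -/
theorem measurableSet_le_clusterMaxIn_real [Countable V] [DecidableEq V] (Λ : Finset V) (r : ℝ) :
    MeasurableSet {ω : BondConfig V | r ≤ (clusterMaxIn Λ ω : ℝ)} := by
  have : {ω : BondConfig V | r ≤ (clusterMaxIn Λ ω : ℝ)} = {ω | ⌈r⌉₊ ≤ clusterMaxIn Λ ω} := by
    ext ω; simp only [Set.mem_setOf_eq, Nat.ceil_le]
  rw [this]; exact measurableSet_clusterMaxIn_ge Λ _

/-- `{|K_max(Λ)| < r}` (real threshold) is measurable. [folklore] -/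
theorem measurableSet_clusterMaxIn_lt_real [Countable V] [DecidableEq V] (Λ : Finset V) (r : ℝ) :
    MeasurableSet {ω : BondConfig V | (clusterMaxIn Λ ω : ℝ) < r} := by
  have : {ω : BondConfig V | (clusterMaxIn Λ ω : ℝ) < r} = {ω | r ≤ (clusterMaxIn Λ ω : ℝ)}ᶜ := by
    ext ω; simp only [Set.mem_setOf_eq, Set.mem_compl_iff, not_le]
  rw [this]; exact (measurableSet_le_clusterMaxIn_real Λ r).compl

end ReachCongr


/-! ### Lemma 2.6 -/

section Lemma26

open MeasureTheory

variable {L : ℕ} (hL : 2 ≤ L) (hd : 1 ≤ d) {o : ℕ → Site d} (ho : IsHierOffset L o)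
  {J : Sym2 (Site d) → ℝ} {c α β : ℝ}

omit hL hd ho in
/-- Children are nonempty. [folklore] -/
theorem nonempty_of_mem_children (hL1 : 1 ≤ L) {n : ℕ} {x : Site d} {B : Finset (Site d)}
    (hB : B ∈ children L o n x) : B.Nonempty := by
  obtain ⟨y, -, rfl⟩ := (mem_children_iff o).1 hB
  exact ⟨y, mem_block_self hL1 o n y⟩

omit hL hd ho in
/-- The `n`-block of a point of a child is that child. [folklore] -/
theorem block_eq_of_mem_children (hL1 : 1 ≤ L) {n : ℕ} {x : Site d} {B : Finset (Site d)} {a : Site d}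
    (hB : B ∈ children L o n x) (ha : a ∈ B) : block L o n a = B := by
  obtain ⟨y, -, rfl⟩ := (mem_children_iff o).1 hB
  exact (block_eq_iff_mem hL1 o).2 ha

omit hL hd ho in
/-- Distinct children are disjoint. [folklore] -/
theorem disjoint_of_mem_children (hL1 : 1 ≤ L) {n : ℕ} {x : Site d} {B₁ B₂ : Finset (Site d)}
    (hB₁ : B₁ ∈ children L o n x) (hB₂ : B₂ ∈ children L o n x) (hne : B₁ ≠ B₂) : Disjoint B₁ B₂ := by
  obtain ⟨y₁, -, rfl⟩ := (mem_children_iff o).1 hB₁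
  obtain ⟨y₂, -, rfl⟩ := (mem_children_iff o).1 hB₂
  rcases block_eq_or_disjoint hL1 o n y₁ y₂ with h | h
  · exact absurd h hne
  · exact h

include hL ho in
/-- **`M_B ≤ 24 M_{B'}` when `E|K^max_B| ≤ E|K^max_{B'}|`** (from (2.7): `(M_B - 1)/e ≤ E|K^max_B| ≤
E|K^max_{B'}| ≤ 4 M_{B'}` and `M_B ≥ 2`; the printed "`M_{B'} ≥ M_B/(9e)`").
[cite: Hutchcroft2022, proof of Lemma 2.6 (p. 10, "we have by (2.7) that M_{B'} ≥ …")] -/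
theorem Mblock_le_of_expMax_le (hc : 0 ≤ c) (hα : 0 ≤ (d : ℝ) + α) (hJ0 : ∀ e, 0 ≤ J e)
    (hJ : HasPowerLowerBound J c α) (hβ : 0 ≤ β) {B B' : Finset (Site d)} (hB : B.Nonempty)
    (hB' : B'.Nonempty) (hE : expMax J L o c α β B ≤ expMax J L o c α β B') :
    (Mblock J L o c α β B : ℝ) ≤ 24 * Mblock J L o c α β B' := by
  have h1 := (expMax_le_and_ge hL ho hc hα hJ0 hJ hβ hB).1
  have h2 := (expMax_le_and_ge hL ho hc hα hJ0 hJ hβ hB').2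
  have hM2 : (2 : ℝ) ≤ Mblock J L o c α β B := by
    unfold Mblock; exact_mod_cast two_le_typicalMax _ hB
  have hM2' : (2 : ℝ) ≤ Mblock J L o c α β B' := by
    unfold Mblock; exact_mod_cast two_le_typicalMax _ hB'
  have he : (1 : ℝ) / 3 ≤ Real.exp (-1) := by
    rw [Real.exp_neg]
    refine (le_inv_comm₀ (by norm_num) (Real.exp_pos 1)).2 ?_
    have := Real.exp_one_lt_d9
    norm_num; linarith
  have hmul : ((Mblock J L o c α β B : ℝ) - 1) * (1 / 3) ≤ ((Mblock J L o c α β B : ℝ) - 1) * Real.exp (-1) :=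
    mul_le_mul_of_nonneg_left he (by linarith)
  linarith

include hL hd ho in
/-- **Few small siblings, one at a time**: for siblings `B, B'` with `E|K^max_B| ≤ E|K^max_{B'}|`,
`P_{β,σ}(|K^max_{B'}(η_B)| < M_B/1536) ≤ 1/8` (lower tail (2.5) for `B'`, `η_{B'} = η_B`).
[cite: Hutchcroft2022, proof of Lemma 2.6 (p. 10, "P(|K^max_{B'}| ≥ … M_B) ≥ 3/4")] -/
theorem hierLaw_real_clusterMaxIn_lt_le (hc : 0 ≤ c) (hα : 0 ≤ (d : ℝ) + α) (hJ0 : ∀ e, 0 ≤ J e)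
    (hJ : HasPowerLowerBound J c α) (hβ : 0 ≤ β) {n : ℕ} {x : Site d} {B B' : Finset (Site d)}
    (hB : B ∈ children L o n x) (hB' : B' ∈ children L o n x)
    (hE : expMax J L o c α β B ≤ expMax J L o c α β B') :
    (hierLaw J L o c α β).real {ξ | (clusterMaxIn B' (etaCfg (aboveFree L o B) ξ) : ℝ) <
      Mblock J L o c α β B / 1536} ≤ 1 / 8 := by
  classical
  have hL1 : 1 ≤ L := le_trans (by norm_num) hL
  have hBne := nonempty_of_mem_children hL1 hB
  have hB'ne := nonempty_of_mem_children hL1 hB'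
  have hM := Mblock_le_of_expMax_le hL ho hc hα hJ0 hJ hβ hBne hB'ne hE
  rw [aboveFree_eq_of_children hL hd ho hB hB']
  have hmeas : MeasurableSet {ω : BondConfig (Site d) |
      (clusterMaxIn B' ω : ℝ) < Mblock J L o c α β B / 1536} := measurableSet_clusterMaxIn_lt_real B' _
  have heq : (hierLaw J L o c α β).real {ξ | (clusterMaxIn B' (etaCfg (aboveFree L o B') ξ) : ℝ) <
        Mblock J L o c α β B / 1536} =
      (etaLaw J L o c α β B').real {ω | (clusterMaxIn B' ω : ℝ) < Mblock J L o c α β B / 1536} := by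
    rw [etaLaw, measureReal_def, measureReal_def, Measure.map_apply (measurable_etaCfg _) hmeas]; rfl
  rw [heq]
  calc (etaLaw J L o c α β B').real {ω | (clusterMaxIn B' ω : ℝ) < Mblock J L o c α β B / 1536}
      ≤ (etaLaw J L o c α β B').real
          {ω | (clusterMaxIn B' ω : ℝ) < (1 / 64) * Mblock J L o c α β B'} := by
        refine measureReal_mono (fun ω hω => ?_) (measure_ne_top _ _)
        simp only [Set.mem_setOf_eq] at hω ⊢
        linarith
    _ ≤ 8 * (1 / 64) := etaLaw_real_clusterMaxIn_lt_le hL ho hc hα hJ0 hJ hβ hB'ne (by norm_num)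
    _ = 1 / 8 := by norm_num

include hL hd ho in
/-- **Two big siblings are unlinked with small probability**: for distinct siblings `B₁, B₂` of `B`
and `r ≥ 0`, the event that `|K^max_{B_i}(η_B)| ≥ r` for `i = 1,2` while no pair `(a,b)`, `a` in the
maximal trace of `B₁`, `b` in that of `B₂`, has its hierarchical copy open, has probability at
most `exp(-cβL^{-(d+α)(n+1)} r²)` (conditionally on `η_B` the copies are independent, each open with
probability `1 - exp(-cβL^{-(d+α)(n+1)})`).
[cite: Hutchcroft2022, proof of Lemma 2.6 (p. 10, "The conditional probability given 𝓕 …")] -/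
theorem hierLaw_real_unlinked_le (hc : 0 ≤ c) (hβ : 0 ≤ β) {n : ℕ} {x : Site d}
    {B B₁ B₂ : Finset (Site d)} (hB : B ∈ children L o n x) (hB₁ : B₁ ∈ children L o n x)
    (hB₂ : B₂ ∈ children L o n x) (hne : B₁ ≠ B₂) {r : ℝ} (hr : 0 ≤ r) :
    (hierLaw J L o c α β).real {ξ | r ≤ (clusterMaxIn B₁ (etaCfg (aboveFree L o B) ξ) : ℝ) ∧
        r ≤ (clusterMaxIn B₂ (etaCfg (aboveFree L o B) ξ) : ℝ) ∧
        ∀ a ∈ maxTrace B₁ (etaCfg (aboveFree L o B) ξ), ∀ b ∈ maxTrace B₂ (etaCfg (aboveFree L o B) ξ),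
          (s(a, b), (1 : Fin 2)) ∉ ξ} ≤
      Real.exp (-(β * (c * ((L : ℝ) ^ (n + 1)) ^ (-((d : ℝ) + α))) * r ^ 2)) := by
  classical
  have hL1 : 1 ≤ L := le_trans (by norm_num) hL
  have hB₁ne := nonempty_of_mem_children hL1 hB₁
  have hB₂ne := nonempty_of_mem_children hL1 hB₂
  have hκ0 : 0 ≤ β * (c * ((L : ℝ) ^ (n + 1)) ^ (-((d : ℝ) + α))) :=
    mul_nonneg hβ (mul_nonneg hc (Real.rpow_nonneg (pow_nonneg (Nat.cast_nonneg _) _) _))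
  set η : Set (Sym2 (Site d) × Fin 2) → BondConfig (Site d) := etaCfg (aboveFree L o B) with hη
  set P := block L o (n + 1) x with hP
  -- the coordinates of the cross copies of `σ(B)`
  set T : Finset (Sym2 (Site d) × Fin 2) :=
    ((P ×ˢ P).filter fun ab => block L o n ab.1 ≠ block L o n ab.2).image
      fun ab => (s(ab.1, ab.2), (1 : Fin 2)) with hT
  have hTmem : ∀ {a b : Site d}, a ∈ P → b ∈ P → block L o n a ≠ block L o n b →
      (s(a, b), (1 : Fin 2)) ∈ T := by
    intro a b ha hb hab
    exact Finset.mem_image.2 ⟨(a, b), Finset.mem_filter.2 ⟨Finset.mem_product.2 ⟨ha, hb⟩, hab⟩, rfl⟩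
  have hTsub : ∀ k ∈ T, k.2 = 1 ∧ k.1 ∈ blockEdges L o (n + 1) x := by
    intro k hk
    obtain ⟨⟨a, b⟩, hab, rfl⟩ := Finset.mem_image.1 hk
    obtain ⟨hab, hblk⟩ := Finset.mem_filter.1 hab
    obtain ⟨ha, hb⟩ := Finset.mem_product.1 hab
    refine ⟨rfl, ?_⟩
    have hca : block L o n a ∈ children L o n x := (mem_children_iff o).2 ⟨a, ha, rfl⟩
    have hcb : block L o n b ∈ children L o n x := (mem_children_iff o).2 ⟨b, hb, rfl⟩
    exact mk_mem_blockEdges_of_children hL ho hca hcb hblk (mem_block_self hL1 o n a)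
      (mem_block_self hL1 o n b)
  have hUT : {k : Sym2 (Site d) × Fin 2 | k.2 = 0 ∨ k.1 ∈ aboveFree L o B} ⊆ (↑T : Set _)ᶜ := by
    intro k hk hkT
    obtain ⟨h2, h1⟩ := hTsub k hkT
    rcases hk with h | h
    · rw [h2] at h; exact absurd h (by decide)
    · exact blockEdges_succ_disjoint_aboveFree hL hd ho hB h1 h
  -- decomposition according to the pair of maximal traces
  set A : Finset (Site d) × Finset (Site d) → Set (Set (Sym2 (Site d) × Fin 2)) := fun D =>
    η ⁻¹' {ω | r ≤ (clusterMaxIn B₁ ω : ℝ) ∧ r ≤ (clusterMaxIn B₂ ω : ℝ) ∧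
      maxTrace B₁ ω = D.1 ∧ maxTrace B₂ ω = D.2} with hA
  set Bv : Finset (Site d) × Finset (Site d) → Set (Set (Sym2 (Site d) × Fin 2)) := fun D =>
    if D.1 ⊆ B₁ ∧ D.2 ⊆ B₂ ∧ r ≤ D.1.card ∧ r ≤ D.2.card then
      {ξ | ∀ a ∈ D.1, ∀ b ∈ D.2, (s(a, b), (1 : Fin 2)) ∉ ξ} else ∅ with hBv
  have hsub : {ξ | r ≤ (clusterMaxIn B₁ (η ξ) : ℝ) ∧ r ≤ (clusterMaxIn B₂ (η ξ) : ℝ) ∧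
      ∀ a ∈ maxTrace B₁ (η ξ), ∀ b ∈ maxTrace B₂ (η ξ), (s(a, b), (1 : Fin 2)) ∉ ξ} ⊆
      ⋃ D, A D ∩ Bv D := by
    intro ξ hξ
    obtain ⟨h1, h2, h3⟩ := hξ
    refine Set.mem_iUnion.2 ⟨(maxTrace B₁ (η ξ), maxTrace B₂ (η ξ)), ⟨h1, h2, rfl, rfl⟩, ?_⟩
    obtain ⟨hc1, hs1, -⟩ := card_maxTrace hB₁ne (η ξ)
    obtain ⟨hc2, hs2, -⟩ := card_maxTrace hB₂ne (η ξ)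
    have hcond : maxTrace B₁ (η ξ) ⊆ B₁ ∧ maxTrace B₂ (η ξ) ⊆ B₂ ∧
        r ≤ (maxTrace B₁ (η ξ)).card ∧ r ≤ (maxTrace B₂ (η ξ)).card :=
      ⟨hs1, hs2, by rw [hc1]; exact h1, by rw [hc2]; exact h2⟩
    show ξ ∈ (if maxTrace B₁ (η ξ) ⊆ B₁ ∧ maxTrace B₂ (η ξ) ⊆ B₂ ∧
        r ≤ (maxTrace B₁ (η ξ)).card ∧ r ≤ (maxTrace B₂ (η ξ)).card then
      {ξ' : Set (Sym2 (Site d) × Fin 2) | ∀ a ∈ maxTrace B₁ (η ξ), ∀ b ∈ maxTrace B₂ (η ξ),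
        (s(a, b), (1 : Fin 2)) ∉ ξ'} else ∅)
    rw [if_pos hcond]
    exact h3
  have hA_det : ∀ D, DeterminedBy (A D) (↑T : Set _)ᶜ := fun D =>
    (determinedBy_preimage_etaCfg (aboveFree L o B) _).mono hUT
  have hB_det : ∀ D, DeterminedBy (Bv D) ↑T := by
    intro D
    simp only [hBv]
    split_ifs with hcond
    · rw [determinedBy_iff]
      intro ξ ξ' hξ
      simp only [Set.mem_setOf_eq]
      refine forall₂_congr fun a ha => forall₂_congr fun b hb => ?_
      have hk : (s(a, b), (1 : Fin 2)) ∈ T := by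
        refine hTmem (subset_of_mem_children hL1 o ho hB₁ (hcond.1 ha))
          (subset_of_mem_children hL1 o ho hB₂ (hcond.2.1 hb)) ?_
        rw [block_eq_of_mem_children hL1 hB₁ (hcond.1 ha), block_eq_of_mem_children hL1 hB₂ (hcond.2.1 hb)]
        exact hne
      have := Set.ext_iff.1 hξ (s(a, b), (1 : Fin 2))
      simp only [Set.mem_inter_iff, Finset.mem_coe, hk, and_true] at this
      exact not_congr this
    · rw [determinedBy_iff]
      intro ξ ξ' _
      simp
  have hA_meas : ∀ D, MeasurableSet (A D) := fun D =>
    (measurable_etaCfg _) ((measurableSet_le_clusterMaxIn_real B₁ r).inter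
      ((measurableSet_le_clusterMaxIn_real B₂ r).inter
        ((measurableSet_maxTrace_eq B₁ D.1).inter (measurableSet_maxTrace_eq B₂ D.2))))
  have hB_meas : ∀ D, MeasurableSet (Bv D) := by
    intro D
    simp only [hBv]
    split_ifs
    · have : {ξ : Set (Sym2 (Site d) × Fin 2) | ∀ a ∈ D.1, ∀ b ∈ D.2, (s(a, b), (1 : Fin 2)) ∉ ξ} =
          ⋂ a ∈ D.1, ⋂ b ∈ D.2, {ξ | (s(a, b), (1 : Fin 2)) ∉ ξ} := by
        ext ξ; simp
      rw [this]
      exact Finset.measurableSet_biInter _ fun a _ =>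
        Finset.measurableSet_biInter _ fun b _ => measurableSet_notMem _
    · exact MeasurableSet.empty
  have hdisj : Pairwise fun D D' => Disjoint (A D) (A D') := by
    intro D D' hne'
    rw [Set.disjoint_left]
    intro ξ h h'
    apply hne'
    simp only [hA, Set.mem_preimage, Set.mem_setOf_eq] at h h'
    exact Prod.ext (h.2.2.1.symm.trans h'.2.2.1) (h.2.2.2.symm.trans h'.2.2.2)
  have hq : ∀ D, (hierLaw J L o c α β).real (Bv D) ≤
      Real.exp (-(β * (c * ((L : ℝ) ^ (n + 1)) ^ (-((d : ℝ) + α))) * r ^ 2)) := by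
    intro D
    simp only [hBv]
    split_ifs with hcond
    · obtain ⟨hD1, hD2, hr1, hr2⟩ := hcond
      rw [hierLaw_real_forall_cross_closed hL ho hc hβ hB₁ hB₂ hne hD1 hD2]
      apply Real.exp_le_exp.2
      have hcard : r ^ 2 ≤ (D.1.card : ℝ) * D.2.card := by
        rw [sq]; exact mul_le_mul hr1 hr2 hr (le_trans hr hr1)
      have := mul_le_mul_of_nonneg_left hcard hκ0
      linarith
    · simp [Real.exp_nonneg]
  have key := prodBernoulli_real_iUnion_inter_le (hierParam J L o c α β) T A Bv hA_det hB_det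
    hA_meas hB_meas hdisj (Real.exp_nonneg _) hq
  calc (hierLaw J L o c α β).real _ ≤ (hierLaw J L o c α β).real (⋃ D, A D ∩ Bv D) :=
        measureReal_mono hsub (measure_ne_top _ _)
    _ ≤ Real.exp (-(β * (c * ((L : ℝ) ^ (n + 1)) ^ (-((d : ℝ) + α))) * r ^ 2)) *
          (hierLaw J L o c α β).real (⋃ D, A D) := key
    _ ≤ Real.exp (-(β * (c * ((L : ℝ) ^ (n + 1)) ^ (-((d : ℝ) + α))) * r ^ 2)) * 1 :=
        mul_le_mul_of_nonneg_left measureReal_le_one (Real.exp_nonneg _)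
    _ = _ := mul_one _

include hL hd ho in
/-- **Linked big siblings make `K^max_{σ(B)}` big** (deterministic step of Lemma 2.6): if the maximal
traces (in `η_B`) of the siblings in `G` are pairwise joined by open hierarchical copies of pairs
of `σ(B)`, then `|K^max_{σ(B)}(η_{σ(B)})| ≥ Σ_{B' ∈ G} |K^max_{B'}(η_B)|` (by (2.4)
`η_{σ(B)} = η_B ∪ ω_{σ(B)}`). [cite: Hutchcroft2022, proof of Lemma 2.6 (p. 10, "|K^max_{σ(B)}| ≥ …")] -/
theorem sum_clusterMaxIn_le_parent {n : ℕ} {x : Site d} {B : Finset (Site d)}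
    (hB : B ∈ children L o n x) {G : Finset (Finset (Site d))} (hG : G ⊆ children L o n x)
    (ξ : Set (Sym2 (Site d) × Fin 2))
    (hlink : ∀ B₁ ∈ G, ∀ B₂ ∈ G, B₁ ≠ B₂ → ∃ a ∈ maxTrace B₁ (etaCfg (aboveFree L o B) ξ),
      ∃ b ∈ maxTrace B₂ (etaCfg (aboveFree L o B) ξ), (s(a, b), (1 : Fin 2)) ∈ ξ) :
    ∑ B' ∈ G, clusterMaxIn B' (etaCfg (aboveFree L o B) ξ) ≤
      clusterMaxIn (block L o (n + 1) x) (etaCfg (aboveFree L o (block L o (n + 1) x)) ξ) := by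
  classical
  have hL1 : 1 ≤ L := le_trans (by norm_num) hL
  set η := etaCfg (aboveFree L o B) ξ with hη
  have hxC : block L o n x ∈ children L o n x :=
    (mem_children_iff o).2 ⟨x, mem_block_self hL1 o _ x, rfl⟩
  have hsplit : etaCfg (aboveFree L o (block L o (n + 1) x)) ξ =
      η ∪ omegaLayer (blockEdges L o (n + 1) x) ξ := by
    rw [etaCfg_aboveFree_succ hL ho hd n x ξ, aboveFree_eq_of_children hL hd ho hxC hB]
  rw [hsplit]
  have hne : ∀ B' ∈ G, B'.Nonempty := fun B' hB' => nonempty_of_mem_children hL1 (hG hB')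
  calc ∑ B' ∈ G, clusterMaxIn B' η = ∑ B' ∈ G, (maxTrace B' η).card :=
        Finset.sum_congr rfl fun B' hB' => ((card_maxTrace (hne B' hB') η).1).symm
    _ ≤ clusterMaxIn (block L o (n + 1) x) (η ∪ omegaLayer (blockEdges L o (n + 1) x) ξ) := by
        refine sum_card_le_clusterMaxIn_union G (fun B' => maxTrace B' η) _ η _ ?_ ?_ ?_ ?_
        · intro B' hB'
          exact ((card_maxTrace (hne B' hB') η).2.1).trans (subset_of_mem_children hL1 o ho (hG hB'))
        · intro B' hB'
          obtain ⟨-, -, v, -, hv⟩ := card_maxTrace (hne B' hB') η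
          exact ⟨v, hv⟩
        · intro B₁ hB₁ B₂ hB₂ hne12
          have hdis : Disjoint B₁ B₂ := disjoint_of_mem_children hL1 (hG hB₁) (hG hB₂) hne12
          exact hdis.mono (card_maxTrace (hne B₁ hB₁) η).2.1 (card_maxTrace (hne B₂ hB₂) η).2.1
        · intro B₁ hB₁ B₂ hB₂ hne12
          obtain ⟨a, ha, b, hb, hab⟩ := hlink B₁ hB₁ B₂ hB₂ hne12
          have haB : a ∈ B₁ := (card_maxTrace (hne B₁ hB₁) η).2.1 ha
          have hbB : b ∈ B₂ := (card_maxTrace (hne B₂ hB₂) η).2.1 hb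
          have hdis : Disjoint B₁ B₂ := disjoint_of_mem_children hL1 (hG hB₁) (hG hB₂) hne12
          refine ⟨a, ha, b, hb, fun h => Finset.disjoint_left.1 hdis haB (h ▸ hbB), ?_⟩
          exact ⟨hab, mk_mem_blockEdges_of_children hL ho (hG hB₁) (hG hB₂) hne12 haB hbB⟩

end Lemma26

section Lemma26Main

open MeasureTheory

/-- **Lemma 2.6 (Renormalization of the maximum cluster size).** There are `L₀ = L₀(d,α) ≥ 2` and,
for `L ≥ L₀`, `A = A(d,α,L) > 0` such that for all offsets `σ`, kernels `J ≥ c‖·‖^{-d-α}`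
(`c > 0`), `β > 0`, `n ≥ 0` and every good `n`-block `B`, child of `σ(B) = B_{n+1}(x)`:
`M_B² ≥ (A/(cβ)) L^{(d+α)n} ⟹ M_{σ(B)}² ≥ (A/(cβ)) L^{(d+α)(n+1)}` (the paper normalises `c = 1`;
constants differ from the printed ones). [cite: Hutchcroft2022, Lemma 2.6] -/
theorem Mblock_sq_renormalisation (hd : 1 ≤ d) {α : ℝ} (hα : 0 ≤ (d : ℝ) + α) (hαd : α < d) :
    ∃ L₀ : ℕ, 2 ≤ L₀ ∧ ∀ L : ℕ, L₀ ≤ L → ∃ A : ℝ, 0 < A ∧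
      ∀ (o : ℕ → Site d), IsHierOffset L o → ∀ (J : Sym2 (Site d) → ℝ) (c β : ℝ), 0 < c → 0 < β →
        (∀ e, 0 ≤ J e) → HasPowerLowerBound J c α →
        ∀ (n : ℕ) (x : Site d) (B : Finset (Site d)), IsGood J L o c α β n x B →
          A / (c * β) * (L : ℝ) ^ (((d : ℝ) + α) * n) ≤ (Mblock J L o c α β B : ℝ) ^ 2 →
          A / (c * β) * (L : ℝ) ^ (((d : ℝ) + α) * (n + 1)) ≤
            (Mblock J L o c α β (block L o (n + 1) x) : ℝ) ^ 2 := by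
  classical
  -- `L₀` with `L₀^{(d-α)/2} ≥ 12288`
  have hγ : 0 < ((d : ℝ) - α) / 2 := div_pos (sub_pos.2 hαd) two_pos
  obtain ⟨L₀, hL₀2, hL₀⟩ : ∃ L₀ : ℕ, 2 ≤ L₀ ∧ ∀ L : ℕ, L₀ ≤ L →
      (12288 : ℝ) ≤ (L : ℝ) ^ (((d : ℝ) - α) / 2) := by
    refine ⟨max 2 ⌈(12288 : ℝ) ^ (1 / (((d : ℝ) - α) / 2))⌉₊, le_max_left _ _, fun L hL => ?_⟩
    have hL' : (12288 : ℝ) ^ (1 / (((d : ℝ) - α) / 2)) ≤ L :=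
      le_trans (Nat.le_ceil _) (by exact_mod_cast le_trans (le_max_right _ _) hL)
    calc (12288 : ℝ) = ((12288 : ℝ) ^ (1 / (((d : ℝ) - α) / 2))) ^ (((d : ℝ) - α) / 2) := by
          rw [← Real.rpow_mul (by norm_num), one_div_mul_cancel hγ.ne', Real.rpow_one]
      _ ≤ (L : ℝ) ^ (((d : ℝ) - α) / 2) :=
          Real.rpow_le_rpow (Real.rpow_nonneg (by norm_num) _) hL' hγ.le
  refine ⟨L₀, hL₀2, fun L hLL => ?_⟩
  have hL : 2 ≤ L := le_trans hL₀2 hLL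
  have hL1 : 1 ≤ L := le_trans (by norm_num) hL
  have hbig := hL₀ L hLL
  have hℓ : (0 : ℝ) < L := by exact_mod_cast (by omega : 0 < L)
  have hℓne : (L : ℝ) ≠ 0 := hℓ.ne'
  have hℓ1 : (1 : ℝ) ≤ L := by exact_mod_cast hL1
  -- the constant `A`
  have hlog : 0 < Real.log (4 * (L : ℝ) ^ (2 * d)) := by
    refine Real.log_pos ?_
    have : (1 : ℝ) ≤ (L : ℝ) ^ (2 * d) := one_le_pow₀ hℓ1
    linarith
  refine ⟨1536 ^ 2 * (L : ℝ) ^ ((d : ℝ) + α) * Real.log (4 * (L : ℝ) ^ (2 * d)),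
    mul_pos (mul_pos (by positivity) (Real.rpow_pos_of_pos hℓ _)) hlog, ?_⟩
  intro o ho J c β hc hβ hJ0 hJ n x B hgood hMB
  set A : ℝ := 1536 ^ 2 * (L : ℝ) ^ ((d : ℝ) + α) * Real.log (4 * (L : ℝ) ^ (2 * d)) with hA
  set μ := hierLaw J L o c α β with hμ
  haveI : IsProbabilityMeasure μ := by rw [hμ]; infer_instance
  set M : ℕ := Mblock J L o c α β B with hM
  set P : Finset (Site d) := block L o (n + 1) x with hP
  set C := children L o n x with hC
  set η : Set (Sym2 (Site d) × Fin 2) → BondConfig (Site d) := etaCfg (aboveFree L o B) with hη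
  set r : ℝ := (M : ℝ) / 1536 with hr
  have hr0 : 0 ≤ r := by positivity
  have hM0 : (0 : ℝ) ≤ M := Nat.cast_nonneg _
  have hBC : B ∈ C := hgood.1
  -- the siblings with larger expected maximum: `B ∈ S`, `3|S| ≥ L^d`
  set S := C.filter fun B' => expMax J L o c α β B ≤ expMax J L o c α β B' with hS
  have hBS : B ∈ S := Finset.mem_filter.2 ⟨hBC, le_rfl⟩
  have hSC : S ⊆ C := Finset.filter_subset _ _
  have hScard : L ^ d ≤ 3 * S.card := by
    have h1 := hgood.2.1
    have hsub : insert B (C.filter fun B' => B' ≠ B ∧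
        expMax J L o c α β B ≤ expMax J L o c α β B') ⊆ S := by
      intro B' hB'
      rcases Finset.mem_insert.1 hB' with rfl | h
      · exact hBS
      · exact Finset.mem_filter.2 ⟨(Finset.mem_filter.1 h).1, (Finset.mem_filter.1 h).2.2⟩
    have h2 := Finset.card_le_card hsub
    rw [Finset.card_insert_of_notMem (fun h => (Finset.mem_filter.1 h).2.1 rfl)] at h2
    have h3 : 1 ≤ S.card := Finset.card_pos.2 ⟨B, hBS⟩
    rw [← hC] at h1
    generalize hN : L ^ d = N at h1 h2 ⊢
    omega
  have hScardR : (L : ℝ) ^ d ≤ 3 * S.card := by exact_mod_cast hScard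
  have hSpos : (0 : ℝ) < S.card := by exact_mod_cast Finset.card_pos.2 ⟨B, hBS⟩
  have hSne : (S.card : ℝ) ≠ 0 := hSpos.ne'
  -- Step 1 (Markov, (2.10)): few small siblings
  set Small : Finset (Site d) → Set (Set (Sym2 (Site d) × Fin 2)) := fun B' =>
    {ξ | (clusterMaxIn B' (η ξ) : ℝ) < r} with hSmall
  have hSmall_meas : ∀ B' ∈ S, MeasurableSet (Small B') := fun B' _ =>
    (measurable_etaCfg _) (measurableSet_clusterMaxIn_lt_real B' r)
  have hSmall_le : ∀ B' ∈ S, μ.real (Small B') ≤ 1 / 8 := fun B' hB' =>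
    hierLaw_real_clusterMaxIn_lt_le hL hd ho hc.le hα hJ0 hJ hβ.le hBC (hSC hB')
      (Finset.mem_filter.1 hB').2
  have hMarkov : μ.real {ξ | (S.card : ℝ) / 2 ≤ ((S.filter fun B' => ξ ∈ Small B').card : ℝ)} ≤
      1 / 4 := by
    have := measureReal_count_ge_le μ S Small hSmall_meas (half_pos hSpos) hSmall_le
    calc _ ≤ (S.card : ℝ) * (1 / 8) / ((S.card : ℝ) / 2) := this
      _ = 1 / 4 := by field_simp; ring
  -- Step 2 (union bound over pairs): all pairs of big siblings are linked
  set Unl : Finset (Site d) → Finset (Site d) → Set (Set (Sym2 (Site d) × Fin 2)) := fun B₁ B₂ =>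
    {ξ | r ≤ (clusterMaxIn B₁ (η ξ) : ℝ) ∧ r ≤ (clusterMaxIn B₂ (η ξ) : ℝ) ∧
      ∀ a ∈ maxTrace B₁ (η ξ), ∀ b ∈ maxTrace B₂ (η ξ), (s(a, b), (1 : Fin 2)) ∉ ξ} with hUnl
  set q : ℝ := Real.exp (-(β * (c * ((L : ℝ) ^ (n + 1)) ^ (-((d : ℝ) + α))) * r ^ 2)) with hq
  have hUnl_le : ∀ p ∈ S.offDiag, μ.real (Unl p.1 p.2) ≤ q := by
    intro p hp
    obtain ⟨h1, h2, h12⟩ := Finset.mem_offDiag.1 hp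
    exact hierLaw_real_unlinked_le hL hd ho hc.le hβ.le hBC (hSC h1) (hSC h2) h12 hr0
  -- the exponent: `cβ L^{-(d+α)(n+1)} r² ≥ log(4L^{2d})`
  have hexp : Real.log (4 * (L : ℝ) ^ (2 * d)) ≤
      β * (c * ((L : ℝ) ^ (n + 1)) ^ (-((d : ℝ) + α))) * r ^ 2 := by
    have hE : ((L : ℝ) ^ (n + 1)) ^ (-((d : ℝ) + α)) * (L : ℝ) ^ (((d : ℝ) + α) * n) *
        (L : ℝ) ^ ((d : ℝ) + α) = 1 := by
      rw [← Real.rpow_natCast (L : ℝ) (n + 1), ← Real.rpow_mul hℓ.le, ← Real.rpow_add hℓ,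
        ← Real.rpow_add hℓ]
      have : ((n + 1 : ℕ) : ℝ) * -((d : ℝ) + α) + ((d : ℝ) + α) * n + ((d : ℝ) + α) = 0 := by
        push_cast; ring
      rw [this, Real.rpow_zero]
    have hEpos : 0 < ((L : ℝ) ^ (n + 1)) ^ (-((d : ℝ) + α)) := Real.rpow_pos_of_pos (pow_pos hℓ _) _
    have hr2 : r ^ 2 = (M : ℝ) ^ 2 / 1536 ^ 2 := by rw [hr, div_pow]
    calc Real.log (4 * (L : ℝ) ^ (2 * d))
        = Real.log (4 * (L : ℝ) ^ (2 * d)) * (((L : ℝ) ^ (n + 1)) ^ (-((d : ℝ) + α)) *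
            (L : ℝ) ^ (((d : ℝ) + α) * n) * (L : ℝ) ^ ((d : ℝ) + α)) := by rw [hE, mul_one]
      _ = β * (c * ((L : ℝ) ^ (n + 1)) ^ (-((d : ℝ) + α))) *
            ((A / (c * β) * (L : ℝ) ^ (((d : ℝ) + α) * n)) / 1536 ^ 2) := by
          rw [hA]; field_simp
      _ ≤ β * (c * ((L : ℝ) ^ (n + 1)) ^ (-((d : ℝ) + α))) * r ^ 2 := by
          apply mul_le_mul_of_nonneg_left _ (by positivity)
          rw [hr2]; exact div_le_div_of_nonneg_right hMB (by positivity)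
  have hq_le : ((L : ℝ) ^ d) ^ 2 * q ≤ 1 / 4 := by
    have h4 : 0 < 4 * (L : ℝ) ^ (2 * d) := by positivity
    have hq' : q ≤ (4 * (L : ℝ) ^ (2 * d))⁻¹ :=
      calc q ≤ Real.exp (-Real.log (4 * (L : ℝ) ^ (2 * d))) := Real.exp_le_exp.2 (neg_le_neg hexp)
        _ = (4 * (L : ℝ) ^ (2 * d))⁻¹ := by rw [Real.exp_neg, Real.exp_log h4]
    calc ((L : ℝ) ^ d) ^ 2 * q ≤ ((L : ℝ) ^ d) ^ 2 * (4 * (L : ℝ) ^ (2 * d))⁻¹ :=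
          mul_le_mul_of_nonneg_left hq' (by positivity)
      _ = 1 / 4 := by rw [← pow_mul, mul_comm d 2]; field_simp
  have hUnion : μ.real (⋃ p ∈ S.offDiag, Unl p.1 p.2) ≤ 1 / 4 := by
    calc μ.real (⋃ p ∈ S.offDiag, Unl p.1 p.2) ≤ ∑ p ∈ S.offDiag, μ.real (Unl p.1 p.2) :=
          measureReal_biUnion_finset_le _ _
      _ ≤ ∑ p ∈ S.offDiag, q := Finset.sum_le_sum hUnl_le
      _ = S.offDiag.card * q := by rw [Finset.sum_const, nsmul_eq_mul]
      _ ≤ ((L : ℝ) ^ d) ^ 2 * q := by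
          apply mul_le_mul_of_nonneg_right _ (Real.exp_nonneg _)
          have h1 : S.offDiag.card ≤ C.card ^ 2 := by
            rw [Finset.offDiag_card]
            have := Finset.card_le_card hSC
            calc S.card * S.card - S.card ≤ S.card * S.card := Nat.sub_le _ _
              _ ≤ C.card * C.card := Nat.mul_le_mul this this
              _ = C.card ^ 2 := (sq _).symm
          rw [hC, card_children hL1 o ho n x] at h1
          exact_mod_cast h1
      _ ≤ 1 / 4 := hq_le
  -- Step 3 (deterministic): outside the two bad events, `|K^max_{σ(B)}| ≥ t := L^{(d+α)/2} M_B`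
  set t : ℝ := (L : ℝ) ^ (((d : ℝ) + α) / 2) * M with ht
  have ht0 : 0 ≤ t := by positivity
  set Target : Set (Set (Sym2 (Site d) × Fin 2)) :=
    (etaCfg (aboveFree L o P)) ⁻¹' {ω | t ≤ (clusterMaxIn P ω : ℝ)} with hTarget
  have hincl : ∀ ξ, ξ ∉ {ξ | (S.card : ℝ) / 2 ≤ ((S.filter fun B' => ξ ∈ Small B').card : ℝ)} →
      ξ ∉ (⋃ p ∈ S.offDiag, Unl p.1 p.2) → ξ ∈ Target := by
    intro ξ h1 h2
    simp only [Set.mem_setOf_eq, not_le] at h1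
    -- the big siblings
    set G := S.filter fun B' => r ≤ (clusterMaxIn B' (η ξ) : ℝ) with hG
    have hGS : G ⊆ S := Finset.filter_subset _ _
    have hGcard : (S.card : ℝ) / 2 < G.card := by
      have hsum := Finset.card_filter_add_card_filter_not (s := S) (fun B' => ξ ∈ Small B')
      have hneg : (S.filter fun B' => ¬ (ξ ∈ Small B')) = G := by
        refine Finset.filter_congr fun B' _ => ?_
        simp only [hSmall, Set.mem_setOf_eq, not_lt]
      rw [hneg] at hsum
      have : ((S.filter fun B' => ξ ∈ Small B').card : ℝ) + G.card = S.card := by exact_mod_cast hsum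
      linarith
    have hlink : ∀ B₁ ∈ G, ∀ B₂ ∈ G, B₁ ≠ B₂ → ∃ a ∈ maxTrace B₁ (η ξ), ∃ b ∈ maxTrace B₂ (η ξ),
        (s(a, b), (1 : Fin 2)) ∈ ξ := by
      intro B₁ hB₁ B₂ hB₂ hne
      have hp : (B₁, B₂) ∈ S.offDiag := Finset.mem_offDiag.2 ⟨hGS hB₁, hGS hB₂, hne⟩
      have hnot : ξ ∉ Unl B₁ B₂ := fun h => h2 (Set.mem_iUnion₂.2 ⟨(B₁, B₂), hp, h⟩)
      simp only [hUnl, Set.mem_setOf_eq, not_and, not_forall, not_not] at hnot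
      obtain ⟨a, ha, b, hb, hab⟩ := hnot (Finset.mem_filter.1 hB₁).2 (Finset.mem_filter.1 hB₂).2
      exact ⟨a, ha, b, hb, hab⟩
    have hsumle := sum_clusterMaxIn_le_parent hL hd ho hBC (hGS.trans hSC) ξ hlink
    have hsumge : (G.card : ℝ) * r ≤ ((∑ B' ∈ G, clusterMaxIn B' (η ξ) : ℕ) : ℝ) := by
      push_cast
      calc (G.card : ℝ) * r = ∑ B' ∈ G, r := by rw [Finset.sum_const, nsmul_eq_mul]
        _ ≤ ∑ B' ∈ G, (clusterMaxIn B' (η ξ) : ℝ) :=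
            Finset.sum_le_sum fun B' hB' => (Finset.mem_filter.1 hB').2
    have htle : t ≤ (S.card : ℝ) / 2 * r := by
      have hsplit : (L : ℝ) ^ d = (L : ℝ) ^ (((d : ℝ) - α) / 2) * (L : ℝ) ^ (((d : ℝ) + α) / 2) := by
        rw [← Real.rpow_add hℓ, ← Real.rpow_natCast]; congr 1; ring
      have h1 : 12288 * (L : ℝ) ^ (((d : ℝ) + α) / 2) ≤ (L : ℝ) ^ d := by
        rw [hsplit]; exact mul_le_mul_of_nonneg_right hbig (by positivity)
      rw [ht, hr]
      nlinarith [mul_le_mul_of_nonneg_right h1 hM0, mul_le_mul_of_nonneg_right hScardR hM0,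
        mul_nonneg hSpos.le hM0]
    show etaCfg (aboveFree L o P) ξ ∈ {ω | t ≤ (clusterMaxIn P ω : ℝ)}
    simp only [Set.mem_setOf_eq]
    calc t ≤ (S.card : ℝ) / 2 * r := htle
      _ ≤ G.card * r := mul_le_mul_of_nonneg_right hGcard.le hr0
      _ ≤ ((∑ B' ∈ G, clusterMaxIn B' (η ξ) : ℕ) : ℝ) := hsumge
      _ ≤ (clusterMaxIn P (etaCfg (aboveFree L o P) ξ) : ℝ) := by exact_mod_cast hsumle
  -- Step 4: `P(Target) ≥ 1/2 > 1/e`, hence `M_{σ(B)} > t`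
  have hTarget_ge : 1 / 2 ≤ μ.real Target := by
    have hcover : (Set.univ : Set (Set (Sym2 (Site d) × Fin 2))) ⊆ Target ∪
        ({ξ | (S.card : ℝ) / 2 ≤ ((S.filter fun B' => ξ ∈ Small B').card : ℝ)} ∪
          ⋃ p ∈ S.offDiag, Unl p.1 p.2) := by
      intro ξ _
      by_cases h1 : ξ ∈ {ξ | (S.card : ℝ) / 2 ≤ ((S.filter fun B' => ξ ∈ Small B').card : ℝ)}
      · exact Or.inr (Or.inl h1)
      by_cases h2 : ξ ∈ ⋃ p ∈ S.offDiag, Unl p.1 p.2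
      · exact Or.inr (Or.inr h2)
      exact Or.inl (hincl ξ h1 h2)
    have h1 : μ.real Set.univ = 1 := probReal_univ
    have := calc (1 : ℝ) = μ.real Set.univ := h1.symm
      _ ≤ μ.real (Target ∪ ({ξ | (S.card : ℝ) / 2 ≤ ((S.filter fun B' => ξ ∈ Small B').card : ℝ)} ∪
          ⋃ p ∈ S.offDiag, Unl p.1 p.2)) := measureReal_mono hcover (measure_ne_top _ _)
      _ ≤ μ.real Target + μ.real ({ξ | (S.card : ℝ) / 2 ≤
            ((S.filter fun B' => ξ ∈ Small B').card : ℝ)} ∪ ⋃ p ∈ S.offDiag, Unl p.1 p.2) :=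
          measureReal_union_le _ _
      _ ≤ μ.real Target + (μ.real {ξ | (S.card : ℝ) / 2 ≤
            ((S.filter fun B' => ξ ∈ Small B').card : ℝ)} + μ.real (⋃ p ∈ S.offDiag, Unl p.1 p.2)) := by
          gcongr; exact measureReal_union_le _ _
      _ ≤ μ.real Target + (1 / 4 + 1 / 4) := by gcongr
    linarith
  have hMP : t < Mblock J L o c α β P := by
    unfold Mblock
    apply lt_typicalMax_of_exp_lt_real
    have hmeasT : MeasurableSet {ω : BondConfig (Site d) | t ≤ (clusterMaxIn P ω : ℝ)} :=
      measurableSet_le_clusterMaxIn_real P t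
    have heq : (etaLaw J L o c α β P).real {ω | t ≤ (clusterMaxIn P ω : ℝ)} = μ.real Target := by
      rw [etaLaw, measureReal_def, measureReal_def, Measure.map_apply (measurable_etaCfg _) hmeasT]
    rw [heq]
    have he : Real.exp (-1) < 1 / 2 := by
      have h2 : (2 : ℝ) < Real.exp 1 := lt_trans (by norm_num) Real.exp_one_gt_d9
      rw [Real.exp_neg]
      calc (Real.exp 1)⁻¹ < 2⁻¹ := (inv_lt_inv₀ (Real.exp_pos 1) two_pos).2 h2
        _ = 1 / 2 := by norm_num
    linarith
  -- Step 5: square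
  have hsq : t ^ 2 < (Mblock J L o c α β P : ℝ) ^ 2 := pow_lt_pow_left₀ hMP ht0 two_ne_zero
  have ht2 : t ^ 2 = (L : ℝ) ^ ((d : ℝ) + α) * (M : ℝ) ^ 2 := by
    rw [ht, mul_pow, ← Real.rpow_natCast ((L : ℝ) ^ (((d : ℝ) + α) / 2)) 2, ← Real.rpow_mul hℓ.le]
    congr 2; push_cast; ring
  have hpow : (L : ℝ) ^ (((d : ℝ) + α) * (n + 1)) =
      (L : ℝ) ^ ((d : ℝ) + α) * (L : ℝ) ^ (((d : ℝ) + α) * n) := by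
    rw [← Real.rpow_add hℓ]; congr 1; ring
  calc A / (c * β) * (L : ℝ) ^ (((d : ℝ) + α) * (n + 1))
      = (L : ℝ) ^ ((d : ℝ) + α) * (A / (c * β) * (L : ℝ) ^ (((d : ℝ) + α) * n)) := by rw [hpow]; ring
    _ ≤ (L : ℝ) ^ ((d : ℝ) + α) * (M : ℝ) ^ 2 := mul_le_mul_of_nonneg_left hMB (by positivity)
    _ = t ^ 2 := ht2.symm
    _ ≤ _ := hsq.le

end Lemma26Main

end Literature.Probability.Percolation

end
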